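import Literature.Geometry.Lorentzian.IPlusRegular
import Literature.Geometry.Lorentzian.KillingOnIntegralCurveUnique
import Literature.Geometry.Lorentzian.NullScreenAlgebra
import HarnessLib

/-!
# Crux `HawkingExtensionIsKerr` (stmt-FinalStateConjecture-17840), line `SketchIdeator2` —
# programme SEC, the section: pointwise preparation (lead c7)

Helper file of the line lead (c7) for programme SEC (a smooth spacelike `K`-section of the
degenerate event horizon), registered sub-goal `stub_sec_sectionPrep`.  Four pointwise lemmas
about a K-chart `(W, O, χ, χi)` — mutually inverse smooth maps between an open `W ⊆ U` and an open
`O ⊆ E4` straightening the collar Killing field, `dχ(K) = e₀`, whose chart lines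
`σ ↦ χi (χ x + σ e₀)` are integral curves of `K` —:

* `sec_lineCoincide` — two K-charts have THE SAME chart line through a common point `x`
  (uniqueness of integral curves of the local Killing field `K` inside `U`,
  `IsKillingFieldOn.eqOn_of_isMIntegralCurveOn`);
* `sec_mfderiv_chartInverse_e0` — `dχi_z (e₀) = K (χi z)` (the chart line is an integral curve);
* `sec_orthogonal_of_horizonCurve` — a curve `r ↦ χi (z + r u)` inside the horizon has initial
  velocity `g`-orthogonal to `K` (HR defining function: `dF = c g(K,·)`, `c ≠ 0`, `F ∘ curve = 0`);
* `sec_pos_of_transverse` — at a horizon point, `g(αK + ξ, αK + ξ) > 0` whenever `ξ ⊥ K` is not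
  a multiple of the null vector `K` (`nonneg_of_orthogonal_null`, `exists_smul_of_orthogonal_null`).
They are conjoined into the registered closed statement `stub_sec_sectionPrep`.
-/

noncomputable section

set_option linter.dupNamespace false

namespace Summit.FinalStateConjecture.FinalStateConjecture.Theorems.HawkingExtensionIsKerr.SketchIdeator2

open Set Filter Bundle Function Literature.Geometry.Lorentzian
open scoped Manifold ContDiff Topology

/-- **Two K-charts have the same chart line through a common point.**  If `(Wᵢ, Oᵢ, χᵢ, χiᵢ)`,
`i = 1, 2`, are inverse pairs with `Wᵢ ⊆ U` whose chart lines are integral curves of the Killing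
field `K` of `U`, then for `x ∈ W₁ ∩ W₂` the two chart lines through `x` agree on every parameter
interval `Ioo a b ∋ 0` on which both stay in their boxes. -/
theorem sec_lineCoincide (𝓑 : StationaryAFBlackHole.{0}) [𝓑.metric.HasLeviCivita]
    (U : Set 𝓑.carrier) (K : Π x : 𝓑.carrier, TangentSpace (𝓡 4) x) (hU : IsOpen U)
    (hK : 𝓑.metric.toPseudoRiemannianMetric.IsKillingFieldOn K U)
    (W₁ W₂ : Set 𝓑.carrier) (O₁ O₂ : Set E4) (χ₁ χ₂ : 𝓑.carrier → E4) (χi₁ χi₂ : E4 → 𝓑.carrier)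
    (hW₁ : W₁ ⊆ U) (hW₂ : W₂ ⊆ U)
    (hinv₁ : ∀ x ∈ W₁, χ₁ x ∈ O₁ ∧ χi₁ (χ₁ x) = x) (hinv₂ : ∀ x ∈ W₂, χ₂ x ∈ O₂ ∧ χi₂ (χ₂ x) = x)
    (hinv₁' : ∀ y ∈ O₁, χi₁ y ∈ W₁ ∧ χ₁ (χi₁ y) = y) (hinv₂' : ∀ y ∈ O₂, χi₂ y ∈ W₂ ∧ χ₂ (χi₂ y) = y)
    (hline₁ : ∀ x ∈ W₁, ∀ a b : ℝ, (∀ σ ∈ Ioo a b, χ₁ x + σ • EuclideanSpace.single 0 1 ∈ O₁) →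
      IsMIntegralCurveOn (fun σ : ℝ ↦ χi₁ (χ₁ x + σ • EuclideanSpace.single 0 1)) K (Ioo a b))
    (hline₂ : ∀ x ∈ W₂, ∀ a b : ℝ, (∀ σ ∈ Ioo a b, χ₂ x + σ • EuclideanSpace.single 0 1 ∈ O₂) →
      IsMIntegralCurveOn (fun σ : ℝ ↦ χi₂ (χ₂ x + σ • EuclideanSpace.single 0 1)) K (Ioo a b))
    {x : 𝓑.carrier} (hx₁ : x ∈ W₁) (hx₂ : x ∈ W₂) {a b : ℝ} (ha : a < 0) (hb : 0 < b)
    (hO₁ : ∀ σ ∈ Ioo a b, χ₁ x + σ • EuclideanSpace.single 0 1 ∈ O₁)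
    (hO₂ : ∀ σ ∈ Ioo a b, χ₂ x + σ • EuclideanSpace.single 0 1 ∈ O₂) :
    ∀ σ ∈ Ioo a b, χi₁ (χ₁ x + σ • EuclideanSpace.single 0 1) =
      χi₂ (χ₂ x + σ • EuclideanSpace.single 0 1) := by
  have h0 : (0 : ℝ) ∈ Ioo a b := ⟨ha, hb⟩
  refine hK.eqOn_of_isMIntegralCurveOn hU isOpen_Ioo ordConnected_Ioo h0 (hline₁ x hx₁ a b hO₁)
    (hline₂ x hx₂ a b hO₂) (fun σ hσ ↦ hW₁ (hinv₁' _ (hO₁ σ hσ)).1)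
    (fun σ hσ ↦ hW₂ (hinv₂' _ (hO₂ σ hσ)).1) ?_
  show χi₁ (χ₁ x + (0 : ℝ) • EuclideanSpace.single 0 1) = χi₂ (χ₂ x + (0 : ℝ) • EuclideanSpace.single 0 1)
  rw [zero_smul, add_zero, add_zero, (hinv₁ x hx₁).2, (hinv₂ x hx₂).2]

/-- **The inverse chart map sends `e₀` to `K`:** `dχi_z (e₀) = K (χi z)` for `z ∈ O` — the chart
line through `χi z` is an integral curve of `K` (hypothesis) and its velocity at `0` is, by the
chain rule, `dχi_z (e₀)`. -/
theorem sec_mfderiv_chartInverse_e0 (𝓑 : StationaryAFBlackHole.{0}) [𝓑.metric.HasLeviCivita]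
    (K : Π x : 𝓑.carrier, TangentSpace (𝓡 4) x)
    (W : Set 𝓑.carrier) (O : Set E4) (χ : 𝓑.carrier → E4) (χi : E4 → 𝓑.carrier)
    (hO : IsOpen O) (hinv' : ∀ y ∈ O, χi y ∈ W ∧ χ (χi y) = y)
    (hχi : ContMDiffOn 𝓘(ℝ, E4) (𝓡 4) ∞ χi O)
    (hline : ∀ x ∈ W, ∀ a b : ℝ, (∀ σ ∈ Ioo a b, χ x + σ • EuclideanSpace.single 0 1 ∈ O) →
      IsMIntegralCurveOn (fun σ : ℝ ↦ χi (χ x + σ • EuclideanSpace.single 0 1)) K (Ioo a b))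
    {z : E4} (hz : z ∈ O) :
    mfderiv 𝓘(ℝ, E4) (𝓡 4) χi z (EuclideanSpace.single 0 1) = K (χi z) := by
  set e0 : E4 := EuclideanSpace.single 0 1 with he0
  -- a small parameter interval on which the line stays in `O`
  have hx : χi z ∈ W := (hinv' z hz).1
  have hχx : χ (χi z) = z := (hinv' z hz).2
  have hcont : Continuous fun σ : ℝ ↦ χ (χi z) + σ • e0 := by fun_prop
  have hpre : IsOpen ((fun σ : ℝ ↦ χ (χi z) + σ • e0) ⁻¹' O) := hO.preimage hcont
  have h0 : (0 : ℝ) ∈ (fun σ : ℝ ↦ χ (χi z) + σ • e0) ⁻¹' O := by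
    show χ (χi z) + (0 : ℝ) • e0 ∈ O
    rwa [zero_smul, add_zero, hχx]
  obtain ⟨ε, hε, hball⟩ := Metric.isOpen_iff.mp hpre 0 h0
  have hseg : ∀ σ ∈ Ioo (-ε) ε, χ (χi z) + σ • e0 ∈ O := fun σ hσ ↦
    hball (by rw [Metric.mem_ball, Real.dist_eq, sub_zero, abs_lt]; exact hσ)
  -- the chart line through `χi z` is an integral curve: its velocity at `0`
  have hint := hline (χi z) hx (-ε) ε hseg
  have hI0 : (0 : ℝ) ∈ Ioo (-ε) ε := ⟨by linarith, hε⟩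
  have hd : HasMFDerivAt 𝓘(ℝ, ℝ) (𝓡 4) (fun σ : ℝ ↦ χi (χ (χi z) + σ • e0)) 0
      ((1 : ℝ →L[ℝ] ℝ).smulRight (K (χi (χ (χi z) + (0 : ℝ) • e0)))) :=
    (hint 0 hI0).hasMFDerivAt (isOpen_Ioo.mem_nhds hI0)
  have hpt : χ (χi z) + (0 : ℝ) • e0 = z := by rw [zero_smul, add_zero, hχx]
  have hd1 : mfderiv 𝓘(ℝ, ℝ) (𝓡 4) (fun σ : ℝ ↦ χi (χ (χi z) + σ • e0)) 0 1 = K (χi z) := by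
    have h := DFunLike.congr_fun hd.mfderiv (1 : ℝ)
    erw [ContinuousLinearMap.smulRight_apply, one_smul] at h
    have gen : ∀ w : E4, w = z →
        (mfderiv 𝓘(ℝ, ℝ) (𝓡 4) (fun σ : ℝ ↦ χi (χ (χi z) + σ • e0)) 0 1 : E4) = (K (χi w) : E4) →
        (mfderiv 𝓘(ℝ, ℝ) (𝓡 4) (fun σ : ℝ ↦ χi (χ (χi z) + σ • e0)) 0 1 : E4) = (K (χi z) : E4) := by
      rintro w rfl h'; exact h'
    exact gen _ hpt h
  -- the same velocity by the chain rule
  have hχid : MDifferentiableAt 𝓘(ℝ, E4) (𝓡 4) χi z :=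
    (hχi.contMDiffAt (hO.mem_nhds hz)).mdifferentiableAt (by simp)
  have hlin : HasMFDerivAt 𝓘(ℝ, ℝ) 𝓘(ℝ, E4) (fun σ : ℝ ↦ χ (χi z) + σ • e0) 0
      ((1 : ℝ →L[ℝ] ℝ).smulRight e0) := by
    have h1 : HasFDerivAt (fun σ : ℝ ↦ χ (χi z) + ((1 : ℝ →L[ℝ] ℝ).smulRight e0) σ)
        ((1 : ℝ →L[ℝ] ℝ).smulRight e0) 0 :=
      ((1 : ℝ →L[ℝ] ℝ).smulRight e0).hasFDerivAt.const_add (χ (χi z))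
    exact h1.hasMFDerivAt
  have hχid' : MDifferentiableAt 𝓘(ℝ, E4) (𝓡 4) χi (χ (χi z) + (0 : ℝ) • e0) := by
    rw [hpt]; exact hχid
  have hcomp := hχid'.hasMFDerivAt.comp (0 : ℝ) hlin
  have hd2 : mfderiv 𝓘(ℝ, ℝ) (𝓡 4) (fun σ : ℝ ↦ χi (χ (χi z) + σ • e0)) 0 1 =
      mfderiv 𝓘(ℝ, E4) (𝓡 4) χi (χ (χi z) + (0 : ℝ) • e0) e0 := by
    have he : ((1 : ℝ →L[ℝ] ℝ).smulRight e0) (1 : ℝ) = e0 := by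
      rw [ContinuousLinearMap.smulRight_apply]
      exact one_smul ℝ e0
    have h : (mfderiv 𝓘(ℝ, ℝ) (𝓡 4) (χi ∘ fun σ : ℝ ↦ χ (χi z) + ((1 : ℝ →L[ℝ] ℝ).smulRight e0) σ) 0 :
        ℝ →L[ℝ] E4) = (mfderiv 𝓘(ℝ, E4) (𝓡 4) χi (χ (χi z) + (0 : ℝ) • e0) : E4 →L[ℝ] E4).comp
        ((1 : ℝ →L[ℝ] ℝ).smulRight e0) := hcomp.mfderiv
    have h1 : (mfderiv 𝓘(ℝ, ℝ) (𝓡 4) (χi ∘ fun σ : ℝ ↦ χ (χi z) + ((1 : ℝ →L[ℝ] ℝ).smulRight e0) σ) 0 :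
        ℝ →L[ℝ] E4) 1 = (mfderiv 𝓘(ℝ, E4) (𝓡 4) χi (χ (χi z) + (0 : ℝ) • e0) : E4 →L[ℝ] E4)
        (((1 : ℝ →L[ℝ] ℝ).smulRight e0) 1) := DFunLike.congr_fun h (1 : ℝ)
    rw [he] at h1
    exact h1
  have key : mfderiv 𝓘(ℝ, E4) (𝓡 4) χi (χ (χi z) + (0 : ℝ) • e0) e0 = K (χi z) := hd2.symm.trans hd1
  have gen : ∀ w : E4, w = z → mfderiv 𝓘(ℝ, E4) (𝓡 4) χi w e0 = K (χi z) →
      mfderiv 𝓘(ℝ, E4) (𝓡 4) χi z e0 = K (χi z) := by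
    rintro w rfl h; exact h
  exact gen _ hpt key

/-- **A transversal curve in the horizon has velocity orthogonal to `K`.**  In a K-chart in which
the horizon is `{χ · 1 = 0}`, the curve `r ↦ χi (z + r u)` with `z 1 = u 1 = 0` runs in the horizon,
so an HR defining function `F` at `χi z` (`{F = 0} = 𝓔⁺` near the point, `dF = c g(K,·)`, `c ≠ 0`)
is constant along it: `g(K, dχi_z u) = 0`. -/
theorem sec_orthogonal_of_horizonCurve (𝓑 : StationaryAFBlackHole.{0}) [𝓑.metric.HasLeviCivita]
    (K : Π x : 𝓑.carrier, TangentSpace (𝓡 4) x)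
    (W : Set 𝓑.carrier) (O : Set E4) (χ : 𝓑.carrier → E4) (χi : E4 → 𝓑.carrier)
    (hO : IsOpen O) (hinv' : ∀ y ∈ O, χi y ∈ W ∧ χ (χi y) = y)
    (hχi : ContMDiffOn 𝓘(ℝ, E4) (𝓡 4) ∞ χi O) (hhor : ∀ x ∈ W, x ∈ 𝓑.horizon ↔ χ x 1 = 0)
    {z : E4} (hz : z ∈ O) (hz1 : z 1 = 0) {u : E4} (hu1 : u 1 = 0)
    {W' : Set 𝓑.carrier} {F : 𝓑.carrier → ℝ} {c : ℝ} (hW' : IsOpen W') (hpW' : χi z ∈ W')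
    (hF : ContMDiffOn (𝓡 4) 𝓘(ℝ, ℝ) ∞ F W') (hFH : ∀ x ∈ W', x ∈ 𝓑.horizon ↔ F x = 0) (hc : c ≠ 0)
    (hdF : ∀ w : TangentSpace (𝓡 4) (χi z),
      mfderiv (𝓡 4) 𝓘(ℝ, ℝ) F (χi z) w = c * 𝓑.metric.val (χi z) (K (χi z)) w) :
    𝓑.metric.val (χi z) (K (χi z)) (mfderiv 𝓘(ℝ, E4) (𝓡 4) χi z u) = 0 := by
  -- the curve and where it lives
  set γ : ℝ → 𝓑.carrier := fun r ↦ χi (z + r • u) with hγ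
  have hlin_cont : Continuous fun r : ℝ ↦ z + r • u := by fun_prop
  have hzr0 : z + (0 : ℝ) • u = z := by rw [zero_smul, add_zero]
  have hO_near : ∀ᶠ r in 𝓝 (0 : ℝ), z + r • u ∈ O := by
    have : (fun r : ℝ ↦ z + r • u) ⁻¹' O ∈ 𝓝 (0 : ℝ) :=
      hlin_cont.continuousAt.preimage_mem_nhds (by rw [hzr0]; exact hO.mem_nhds hz)
    exact this
  have hχi_cont : ContinuousAt χi z := (hχi.continuousOn.continuousWithinAt hz).continuousAt (hO.mem_nhds hz)
  have hW'_near : ∀ᶠ r in 𝓝 (0 : ℝ), γ r ∈ W' := by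
    have h1 : ContinuousAt γ 0 := by
      have : ContinuousAt χi (z + (0 : ℝ) • u) := by rw [hzr0]; exact hχi_cont
      exact ContinuousAt.comp (f := fun r : ℝ ↦ z + r • u) (x := (0 : ℝ)) this hlin_cont.continuousAt
    have h2 : W' ∈ 𝓝 (γ 0) := by
      apply hW'.mem_nhds
      show χi (z + (0 : ℝ) • u) ∈ W'
      rw [hzr0]; exact hpW'
    exact h1.preimage_mem_nhds h2
  -- `F ∘ γ` vanishes near `0`
  have hzero : ∀ᶠ r in 𝓝 (0 : ℝ), F (γ r) = 0 := by
    filter_upwards [hO_near, hW'_near] with r hrO hrW'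
    have hmem : γ r ∈ W := (hinv' _ hrO).1
    have hcoord : χ (γ r) 1 = 0 := by
      show χ (χi (z + r • u)) 1 = 0
      rw [(hinv' _ hrO).2]
      simp [hz1, hu1]
    exact (hFH _ hrW').1 ((hhor _ hmem).2 hcoord)
  have hderiv0 : mfderiv 𝓘(ℝ, ℝ) 𝓘(ℝ, ℝ) (fun r ↦ F (γ r)) 0 = 0 := by
    have h : (fun r ↦ F (γ r)) =ᶠ[𝓝 (0 : ℝ)] fun _ ↦ (0 : ℝ) := hzero
    rw [h.mfderiv_eq]; exact mfderiv_const
  -- the chain rule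
  have hχid : MDifferentiableAt 𝓘(ℝ, E4) (𝓡 4) χi (z + (0 : ℝ) • u) := by
    rw [hzr0]; exact (hχi.contMDiffAt (hO.mem_nhds hz)).mdifferentiableAt (by simp)
  have hlin : HasMFDerivAt 𝓘(ℝ, ℝ) 𝓘(ℝ, E4) (fun r : ℝ ↦ z + ((1 : ℝ →L[ℝ] ℝ).smulRight u) r) 0
      ((1 : ℝ →L[ℝ] ℝ).smulRight u) :=
    (((1 : ℝ →L[ℝ] ℝ).smulRight u).hasFDerivAt.const_add z).hasMFDerivAt
  have hγd : HasMFDerivAt 𝓘(ℝ, ℝ) (𝓡 4) γ 0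
      ((mfderiv 𝓘(ℝ, E4) (𝓡 4) χi (z + (0 : ℝ) • u)).comp ((1 : ℝ →L[ℝ] ℝ).smulRight u)) :=
    hχid.hasMFDerivAt.comp (0 : ℝ) hlin
  have hFd : MDifferentiableAt (𝓡 4) 𝓘(ℝ, ℝ) F (γ 0) := by
    have : γ 0 = χi z := by show χi (z + (0 : ℝ) • u) = χi z; rw [hzr0]
    rw [this]
    exact (hF.contMDiffAt (hW'.mem_nhds hpW')).mdifferentiableAt (by simp)
  have hFγ := hFd.hasMFDerivAt.comp (0 : ℝ) hγd
  have hcomp0 : (mfderiv (𝓡 4) 𝓘(ℝ, ℝ) F (γ 0)).comp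
      ((mfderiv 𝓘(ℝ, E4) (𝓡 4) χi (z + (0 : ℝ) • u)).comp ((1 : ℝ →L[ℝ] ℝ).smulRight u)) = 0 :=
    hFγ.mfderiv.symm.trans hderiv0
  have hu : ((1 : ℝ →L[ℝ] ℝ).smulRight u) (1 : ℝ) = u := by
    rw [ContinuousLinearMap.smulRight_apply]; exact one_smul ℝ u
  have h1 : (mfderiv (𝓡 4) 𝓘(ℝ, ℝ) F (γ 0) : E4 →L[ℝ] ℝ)
      ((mfderiv 𝓘(ℝ, E4) (𝓡 4) χi (z + (0 : ℝ) • u) : E4 →L[ℝ] E4)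
        (((1 : ℝ →L[ℝ] ℝ).smulRight u) 1)) = 0 := DFunLike.congr_fun hcomp0 (1 : ℝ)
  rw [hu] at h1
  -- transport to the point `z`
  have key : ∀ w : E4, w = z → (mfderiv (𝓡 4) 𝓘(ℝ, ℝ) F (χi w) : E4 →L[ℝ] ℝ)
      ((mfderiv 𝓘(ℝ, E4) (𝓡 4) χi w : E4 →L[ℝ] E4) u) = 0 →
      (mfderiv (𝓡 4) 𝓘(ℝ, ℝ) F (χi z) : E4 →L[ℝ] ℝ) ((mfderiv 𝓘(ℝ, E4) (𝓡 4) χi z : E4 →L[ℝ] E4) u) = 0 := by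
    rintro w rfl h; exact h
  have h2 := key _ hzr0 h1
  have h3 : c * 𝓑.metric.val (χi z) (K (χi z)) (mfderiv 𝓘(ℝ, E4) (𝓡 4) χi z u) = 0 := by
    rw [← hdF]; exact h2
  exact (mul_eq_zero.mp h3).resolve_left hc

/-- **Positivity on transverse vectors of the null hyperplane `K^⊥`.**  At a point where `K` is null
and nonzero, for `ξ ⊥ K`: `g(αK + ξ, αK + ξ) = g(ξ, ξ) ≥ 0`, with equality only if `ξ ∈ ℝ K`
(`nonneg_of_orthogonal_null`, `exists_smul_of_orthogonal_null` for the Lorentzian scalar product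
`g_p`). -/
theorem sec_pos_of_transverse (𝓑 : StationaryAFBlackHole.{0}) (p : 𝓑.carrier)
    (Kp ξ : E4) (α : ℝ) (hK0 : 𝓑.metric.val p Kp Kp = 0) (hKne : Kp ≠ 0)
    (hξ : 𝓑.metric.val p Kp ξ = 0) :
    𝓑.metric.val p (α • Kp + ξ) (α • Kp + ξ) = 𝓑.metric.val p ξ ξ ∧ 0 ≤ 𝓑.metric.val p ξ ξ ∧
      (𝓑.metric.val p ξ ξ = 0 → ∃ c : ℝ, ξ = c • Kp) := by
  set B : E4 →L[ℝ] E4 →L[ℝ] ℝ := 𝓑.metric.val p with hB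
  have hsymm : ∀ v w : E4, B v w = B w v := fun v w ↦ 𝓑.metric.symm p v w
  have hξ' : B ξ Kp = 0 := by rw [hsymm]; exact hξ
  have hpos : ∀ t w : E4, B t t < 0 → B t w = 0 → w ≠ 0 → 0 < B w w :=
    fun t w ht htw hw ↦ 𝓑.metric.pos_of_orthogonal p t w ht htw hw
  refine ⟨?_, nonneg_of_orthogonal_null B hpos hK0 hKne hξ', fun h0 ↦ ?_⟩
  · show B (α • Kp + ξ) (α • Kp + ξ) = B ξ ξ
    have h1 : B Kp Kp = 0 := hK0
    have h2 : B Kp ξ = 0 := hξ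
    simp [h1, h2, hξ']
  · obtain ⟨T, hT⟩ := 𝓑.metric.exists_timelike p
    exact exists_smul_of_orthogonal_null B hsymm hpos hT hK0 hKne hξ' h0

/-- **Registered sub-goal form (closed statement, crux stmt-FinalStateConjecture-17840, programme SEC):**
the four pointwise preparation lemmas of the section, conjoined — (1) chart lines of two K-charts
through a common point coincide; (2) `dχi (e₀) = K`; (3) transversal curves in the horizon are
`g`-orthogonal to `K`; (4) positivity of `g` on transverse vectors of `K^⊥`. -/
theorem stub_sec_sectionPrep : (∀ (𝓑 : StationaryAFBlackHole.{0}) [𝓑.metric.HasLeviCivita] (U : Set 𝓑.carrier) (K : Π x : 𝓑.carrier, TangentSpace (𝓡 4) x), IsOpen U → 𝓑.metric.toPseudoRiemannianMetric.IsKillingFieldOn K U → ∀ (W₁ W₂ : Set 𝓑.carrier) (O₁ O₂ : Set E4) (χ₁ χ₂ : 𝓑.carrier → E4) (χi₁ χi₂ : E4 → 𝓑.carrier), W₁ ⊆ U → W₂ ⊆ U → (∀ x ∈ W₁, χ₁ x ∈ O₁ ∧ χi₁ (χ₁ x) = x) → (∀ x ∈ W₂, χ₂ x ∈ O₂ ∧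 χi₂ (χ₂ x) = x) → (∀ y ∈ O₁, χi₁ y ∈ W₁ ∧ χ₁ (χi₁ y) = y) → (∀ y ∈ O₂, χi₂ y ∈ W₂ ∧ χ₂ (χi₂ y) = y) → (∀ x ∈ W₁, ∀ a b : ℝ, (∀ σ ∈ Ioo a b, χ₁ x + σ • EuclideanSpace.single 0 1 ∈ O₁) → IsMIntegralCurveOn (fun σ : ℝ ↦ χi₁ (χ₁ x + σ • EuclideanSpace.single 0 1)) K (Ioo a b)) → (∀ x ∈ W₂, ∀ a b : ℝ, (∀ σ ∈ Ioo a b, χ₂ x + σ • EuclideanSpace.single 0 1 ∈ O₂) → IsMIntegralCurveOn (fun σ : ℝ ↦ χi₂ (χ₂ x + σ • EuclideanSpace.single 0 1)) K (Ioo a b)) → ∀ x ∈ W₁ ∩ W₂, ∀ a b : ℝ, a < 0 → 0 < b → (∀ σ ∈ Ioo a b, χ₁ x + σ • EuclideanSpace.single 0 1 ∈ O₁) → (∀ σ ∈ Ioo a b, χ₂ x + σ • EuclideanSpace.single 0 1 ∈ O₂) → ∀ σ ∈ Ioo a b, χi₁ (χ₁ x + σ • EuclideanSpace.single 0 1) =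 χi₂ (χ₂ x + σ • EuclideanSpace.single 0 1)) ∧
    (∀ (𝓑 : StationaryAFBlackHole.{0}) [𝓑.metric.HasLeviCivita] (K : Π x : 𝓑.carrier, TangentSpace (𝓡 4) x) (W : Set 𝓑.carrier) (O : Set E4) (χ : 𝓑.carrier → E4) (χi : E4 → 𝓑.carrier), IsOpen O → (∀ y ∈ O, χi y ∈ W ∧ χ (χi y) = y) → ContMDiffOn 𝓘(ℝ, E4) (𝓡 4) ∞ χi O → (∀ x ∈ W, ∀ a b : ℝ, (∀ σ ∈ Ioo a b, χ x + σ • EuclideanSpace.single 0 1 ∈ O) → IsMIntegralCurveOn (fun σ : ℝ ↦ χi (χ x + σ • EuclideanSpace.single 0 1)) K (Ioo a b)) → ∀ z ∈ O, mfderiv 𝓘(ℝ, E4) (𝓡 4) χi z (EuclideanSpace.single 0 1) = K (χi z)) ∧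
    (∀ (𝓑 : StationaryAFBlackHole.{0}) [𝓑.metric.HasLeviCivita] (K : Π x : 𝓑.carrier, TangentSpace (𝓡 4) x) (W : Set 𝓑.carrier) (O : Set E4) (χ : 𝓑.carrier → E4) (χi : E4 → 𝓑.carrier), IsOpen O → (∀ y ∈ O, χi y ∈ W ∧ χ (χi y) = y) → ContMDiffOn 𝓘(ℝ, E4) (𝓡 4) ∞ χi O → (∀ x ∈ W, x ∈ 𝓑.horizon ↔ χ x 1 = 0) → ∀ (z u : E4) (W' : Set 𝓑.carrier) (F : 𝓑.carrier → ℝ) (c : ℝ), z ∈ O → z 1 = 0 → u 1 = 0 → IsOpen W' → χi z ∈ W' → ContMDiffOn (𝓡 4) 𝓘(ℝ, ℝ) ∞ F W' → (∀ x ∈ W', x ∈ 𝓑.horizon ↔ F x = 0) → c ≠ 0 → (∀ w : TangentSpace (𝓡 4) (χi z), mfderiv (𝓡 4) 𝓘(ℝ, ℝ) F (χi z) w = c * 𝓑.metric.val (χi z) (K (χi z)) w) → 𝓑.metric.val (χi z) (K (χi z)) (mfderiv 𝓘(ℝ, E4) (𝓡 4) χi z u) = 0) ∧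
    (∀ (𝓑 : StationaryAFBlackHole.{0}) (p : 𝓑.carrier) (Kp ξ : E4) (α : ℝ), 𝓑.metric.val p Kp Kp = 0 → Kp ≠ 0 → 𝓑.metric.val p Kp ξ = 0 → 𝓑.metric.val p (α • Kp + ξ) (α • Kp + ξ) = 𝓑.metric.val p ξ ξ ∧ 0 ≤ 𝓑.metric.val p ξ ξ ∧ (𝓑.metric.val p ξ ξ = 0 → ∃ c : ℝ, ξ = c • Kp)) :=
  ⟨fun 𝓑 _ U K hU hK W₁ W₂ O₁ O₂ χ₁ χ₂ χi₁ χi₂ hW₁ hW₂ h₁ h₂ h₁' h₂' hl₁ hl₂ _ hx _ _ ha hb hO₁ hO₂ ↦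
      sec_lineCoincide 𝓑 U K hU hK W₁ W₂ O₁ O₂ χ₁ χ₂ χi₁ χi₂ hW₁ hW₂ h₁ h₂ h₁' h₂' hl₁ hl₂ hx.1 hx.2 ha hb hO₁ hO₂,
    fun 𝓑 _ K W O χ χi hO hinv' hχi hline _ hz ↦ sec_mfderiv_chartInverse_e0 𝓑 K W O χ χi hO hinv' hχi hline hz,
    fun 𝓑 _ K W O χ χi hO hinv' hχi hhor _ _ _ _ _ hz hz1 hu1 hW' hpW' hF hFH hc hdF ↦
      sec_orthogonal_of_horizonCurve 𝓑 K W O χ χi hO hinv' hχi hhor hz hz1 hu1 hW' hpW' hF hFH hc hdF,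
    fun 𝓑 p Kp ξ α hK0 hKne hξ ↦ sec_pos_of_transverse 𝓑 p Kp ξ α hK0 hKne hξ⟩

end Summit.FinalStateConjecture.FinalStateConjecture.Theorems.HawkingExtensionIsKerr.SketchIdeator2

end
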